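import Literature.NumberTheory.Automorphic.MirabolicTower
import Literature.NumberTheory.Automorphic.UnipotentColumnRange
import Literature.NumberTheory.Automorphic.MirabolicTowerInvariance
import HarnessLib

/-!
# The invariance groups of the Fourier–Whittaker tower: `H'_m = GL_m(K) U^{(m)}(𝔸_K)` and
`H_m = P_m(K) U^{(m)}(𝔸_K)` as closed subgroups of `GL_n(𝔸_K)`
(Jacquet–Shalika (1981), §4; Cogdell (2004), §1.1, §2.3: the groups of the unfolding
`P_n(K)\GL_n(𝔸) → ⋯ → N_n(𝔸)\GL_n(𝔸)`)

Topic `NumberTheory/Automorphic`; namespace `Literature.NumberTheory.Automorphic`. The mean-square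
Fourier–Whittaker tower (`MirabolicFourierStage`, …, `CuspidalTowerGeneric`) produces functions
`Φ_m` on `GL_n(𝔸_K)` with `|Φ_m|²` left invariant under `H_m = diag(P_m(K), 1) · U^{(m)}(𝔸_K)` and
stage integrands left invariant under `H'_m = diag(GL_m(K), 1) · U^{(m)}(𝔸_K)`, where
`U^{(m)} = U_{[m, n-1]}` (`unipotentColRange` of `UnipotentColumnRange`: upper unitriangular with
non-trivial entries only in the columns `≥ m`) and `P_m ≤ GL_m` is the mirabolic. To integrate the
pointwise stage identities over `GL_n(𝔸_K)` (invariant measures on `GL_n(𝔸_K) ⧸ H`, Weil's formula,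
integration in stages `InvariantQuotientChainRule`) these groups must be available as **closed
subgroups** of `GL_n(𝔸_K)` with their nesting and their coset models. This file provides the
group theory (everything proved):

* `ratTail n S m ≤ GL_n(R)` (**definition**, any commutative ring `R` with a subring `S`): the
  elements of `Q_m` (`tailUnipotent n R m` of `MirabolicTower`: the rows `≥ m` are unitriangular rows)
  whose upper-left `m × m` corner — of the matrix and of its inverse — has entries in `S`; for
  `R = 𝔸_K`, `S = K` this is `H'_m` (`towerGroup' n K m`), and `towerGroup n K m = H'_m ⊓ Q_{m-1}` is
  `H_m` (the corner lies in the mirabolic);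
* membership: `unipotentColRange n R m b ≤ ratTail n S m`, the rational corner
  (`glCorner_mem_ratTail`, adelically `glCorner_ratGL_mem_towerGroup'`), the corner lies in `H_m` iff
  it is in the mirabolic (`glCorner_ratGL_mem_towerGroup_iff`), the column group
  (`colUnipotent_mem_towerGroup`, and `colUnipotent_mem_towerGroup_succ_iff`: `u_m(v) ∈ H_{m+1}` iff
  `v ∈ K^m`);
* nesting: `towerGroup_le_towerGroup'` (`H_m ≤ H'_m`), `towerGroup_succ_le_towerGroup'`
  (`H_{m+1} ≤ H'_m`);
* **decomposition** `exists_glCorner_ratGL_mul_eq`: every `g ∈ H'_m` is `diag(γ_𝔸, 1) · u` with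
  `γ ∈ GL_m(K)` and `u ∈ U^{(m)}(𝔸_K)`, uniquely (`glCorner_ratGL_mul_eq_iff`);
* topology: `isClosed_towerGroup'`, `isClosed_towerGroup` (entry conditions; `K ⊂ 𝔸_K` is closed),
  and **`U^{(m)}(𝔸_K)` is open in `H'_m`** (`isOpen_adelicColRange_subgroupOf_towerGroup'`: the corner
  entries of elements of `H'_m` lie in the discrete set `K`), hence `H_m` is open in `H'_m` and the
  coset space `H'_m ⧸ H_m` is discrete (`discreteTopology_towerGroup'_quotient`).

## References

* H. Jacquet, J. A. Shalika, Amer. J. Math. 103 (1981), §4 [JacquetShalikaAJM1981].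
* J. W. Cogdell, in Bernstein–Gelbart (eds.), *An Introduction to the Langlands Program* (2004),
  §1.1, §2.3 [CogdellAnalyticTheory2004].
-/

noncomputable section

open scoped Matrix MatrixGroups Pointwise
open NumberField IsDedekindDomain Matrix Set
open Literature.LinearAlgebra.Matrix

namespace Literature.NumberTheory.Automorphic

/-! ### `Q_m` with `S`-rational corner -/

section Ring

variable {R : Type*} [CommRing R] (n : ℕ) (S : Subring R) (m : ℕ)

/-- **`Q_m` with `S`-rational corner**: the `g ∈ Q_m = tailUnipotent n R m` (rows `≥ m` are
unitriangular rows) such that the entries `g_{ij}`, `(g⁻¹)_{ij}` with `i, j < m` lie in the subring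
`S`. For `R = 𝔸_K ⊇ S = K` this is `diag(GL_m(K), 1) · U^{(m)}(𝔸_K)` (`exists_glCorner_ratGL_mul_eq`).
[cite: CogdellAnalyticTheory2004, §1.1] -/
def ratTail : Subgroup (GL (Fin n) R) where
  carrier := {g | g ∈ tailUnipotent n R m ∧ ∀ i j : Fin n, (i : ℕ) < m → (j : ℕ) < m →
    (g : Matrix (Fin n) (Fin n) R) i j ∈ S ∧ ((g⁻¹ : GL (Fin n) R) : Matrix (Fin n) (Fin n) R) i j ∈ S}
  one_mem' := by
    refine ⟨(tailUnipotent n R m).one_mem, fun i j _ _ => ?_⟩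
    rw [inv_one, Units.val_one, Matrix.one_apply]
    split_ifs
    · exact ⟨S.one_mem, S.one_mem⟩
    · exact ⟨S.zero_mem, S.zero_mem⟩
  mul_mem' := by
    rintro g h ⟨hg, hg'⟩ ⟨hh, hh'⟩
    have key : ∀ {a b : GL (Fin n) R}, b ∈ tailUnipotent n R m →
        (∀ i j : Fin n, (i : ℕ) < m → (j : ℕ) < m → (a : Matrix (Fin n) (Fin n) R) i j ∈ S) →
        (∀ i j : Fin n, (i : ℕ) < m → (j : ℕ) < m → (b : Matrix (Fin n) (Fin n) R) i j ∈ S) →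
        ∀ i j : Fin n, (i : ℕ) < m → (j : ℕ) < m → ((a * b : GL (Fin n) R) : Matrix (Fin n) (Fin n) R) i j ∈ S := by
      intro a b hb ha' hb' i j hi hj
      rw [Units.val_mul, Matrix.mul_apply]
      refine S.sum_mem fun l _ => ?_
      by_cases hl : (l : ℕ) < m
      · exact S.mul_mem (ha' i l hi hl) (hb' l j hl hj)
      · have hlj : j ≤ l := Fin.le_iff_val_le_val.2 (by omega)
        rw [mem_tailUnipotent_iff.1 hb l j (not_lt.1 hl) hlj,
          if_neg (fun e => by rw [e] at hl; exact hl hj), mul_zero]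
        exact S.zero_mem
    refine ⟨(tailUnipotent n R m).mul_mem hg hh, fun i j hi hj => ⟨?_, ?_⟩⟩
    · exact key hh (fun i j hi hj => (hg' i j hi hj).1) (fun i j hi hj => (hh' i j hi hj).1) i j hi hj
    · rw [_root_.mul_inv_rev]
      exact key ((tailUnipotent n R m).inv_mem hg) (fun i j hi hj => (hh' i j hi hj).2)
        (fun i j hi hj => (hg' i j hi hj).2) i j hi hj
  inv_mem' := by
    rintro g ⟨hg, hg'⟩
    refine ⟨(tailUnipotent n R m).inv_mem hg, fun i j hi hj => ⟨(hg' i j hi hj).2, ?_⟩⟩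
    rw [inv_inv]; exact (hg' i j hi hj).1

variable {n S m}

/-- Membership in `ratTail`. [folklore] -/
theorem mem_ratTail_iff {g : GL (Fin n) R} :
    g ∈ ratTail n S m ↔ g ∈ tailUnipotent n R m ∧ ∀ i j : Fin n, (i : ℕ) < m → (j : ℕ) < m →
      (g : Matrix (Fin n) (Fin n) R) i j ∈ S ∧ ((g⁻¹ : GL (Fin n) R) : Matrix (Fin n) (Fin n) R) i j ∈ S :=
  Iff.rfl

variable (n S m) in
/-- `ratTail n S m ≤ Q_m`. [folklore] -/
theorem ratTail_le_tailUnipotent : ratTail n S m ≤ tailUnipotent n R m := fun _ hg => hg.1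

variable (S) in
/-- **`U_{[m,b]} ≤ ratTail n S m`**: the corner of such a unipotent is `1`. [folklore] -/
theorem unipotentColRange_le_ratTail (b : ℕ) : unipotentColRange n R m b ≤ ratTail n S m := by
  intro u hu
  have hcor : ∀ {v : GL (Fin n) R}, v ∈ unipotentColRange n R m b → ∀ i j : Fin n, (i : ℕ) < m →
      (j : ℕ) < m → (v : Matrix (Fin n) (Fin n) R) i j ∈ S := by
    intro v hv i j _ hj
    rw [apply_of_not_inColRange hv i (fun h => absurd h.1 (by omega)), ]
    split_ifs
    · exact S.one_mem
    · exact S.zero_mem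
  exact ⟨unipotentColRange_le_tailUnipotent m b m hu, fun i j hi hj =>
    ⟨hcor hu i j hi hj, hcor ((unipotentColRange n R m b).inv_mem hu) i j hi hj⟩⟩

/-- `ratTail n S (m+1) ⊓ Q_m ≤ ratTail n S m` (`H_{m+1} ≤ H'_m`). [folklore] -/
theorem ratTail_succ_inf_tailUnipotent_le :
    ratTail n S (m + 1) ⊓ tailUnipotent n R m ≤ ratTail n S m := by
  rintro g ⟨⟨-, hg'⟩, hg⟩
  exact ⟨hg, fun i j hi hj => hg' i j (by omega) (by omega)⟩

/-- **The corner `diag(γ, 1)` lies in `Q_m`.** [folklore] -/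
theorem glCorner_mem_tailUnipotent (hm : m ≤ n) (γ : GL (Fin m) R) :
    glCorner R hm γ ∈ tailUnipotent n R m := by
  intro i j hi hji
  rw [glCorner_apply_val, dif_neg (by omega)]
  by_cases hj : (j : ℕ) < m
  · rw [if_pos hj, if_neg (fun e => by rw [e] at hi; omega)]
  · rw [if_neg hj]

/-- **The corner of a matrix with `S`-rational entries lies in `ratTail n S m`.** [folklore] -/
theorem glCorner_mem_ratTail (hm : m ≤ n) (γ : GL (Fin m) R)
    (hγ : ∀ i j : Fin m, (γ : Matrix (Fin m) (Fin m) R) i j ∈ S)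
    (hγ' : ∀ i j : Fin m, ((γ⁻¹ : GL (Fin m) R) : Matrix (Fin m) (Fin m) R) i j ∈ S) :
    glCorner R hm γ ∈ ratTail n S m := by
  refine ⟨glCorner_mem_tailUnipotent hm γ, fun i j hi hj => ?_⟩
  rw [← map_inv, glCorner_apply_val, glCorner_apply_val, dif_pos hi, dif_pos hj, dif_pos hi, dif_pos hj]
  exact ⟨hγ _ _, hγ' _ _⟩

/-- The corner on the corner indices: `diag(γ, 1)_{ij} = γ_{ij}` for `i, j < m` (`Fin.castLE`). [folklore] -/
theorem glCorner_apply_castLE (hm : m ≤ n) (γ : GL (Fin m) R) (i j : Fin m) :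
    ((glCorner R hm γ : GL (Fin n) R) : Matrix (Fin n) (Fin n) R) (Fin.castLE hm i) (Fin.castLE hm j) =
      (γ : Matrix (Fin m) (Fin m) R) i j := by
  rw [glCorner_apply_val, dif_pos (by simp), dif_pos (by simp)]
  rfl

/-- **The corner lies in `Q_c` iff its last row is `(0, …, 0, 1)`** (`γ ∈ GL_{c+1}`). [folklore] -/
theorem glCorner_mem_tailUnipotent_iff_row {c : ℕ} (h : c + 1 ≤ n) (γ : GL (Fin (c + 1)) R) :
    glCorner R h γ ∈ tailUnipotent n R c ↔
      ∀ j : Fin (c + 1), (γ : Matrix (Fin (c + 1)) (Fin (c + 1)) R) (Fin.last c) j =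
        if j = Fin.last c then 1 else 0 := by
  constructor
  · intro hg j
    have := hg (Fin.castLE h (Fin.last c)) (Fin.castLE h j) (by simp)
      (Fin.le_iff_val_le_val.2 (by have := j.isLt; simp only [Fin.val_castLE, Fin.val_last]; omega))
    rw [glCorner_apply_castLE] at this
    simpa [eq_comm] using this
  · intro hrow i j hi hji
    rw [glCorner_apply_val]
    by_cases hi' : (i : ℕ) < c + 1
    · have hic : (i : ℕ) = c := by omega
      rw [dif_pos hi']
      have hj' : (j : ℕ) < c + 1 := by have := Fin.le_iff_val_le_val.1 hji; omega
      rw [dif_pos hj']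
      have e : (⟨(i : ℕ), hi'⟩ : Fin (c + 1)) = Fin.last c := Fin.ext (by simp [hic])
      rw [e, hrow]
      simp only [Fin.ext_iff, Fin.val_last]
      by_cases hjc : (j : ℕ) = c
      · rw [if_pos hjc, if_pos (by omega)]
      · rw [if_neg hjc, if_neg (by omega)]
    · rw [dif_neg hi']
      by_cases hj' : (j : ℕ) < c + 1
      · rw [if_pos hj', if_neg (fun e => by rw [e] at hi'; exact hi' hj')]
      · rw [if_neg hj']

/-- **The column unipotent `u(v)` lies in the column group `U_{[m,m]}`.** [folklore] -/
theorem colUnipotent_mem_unipotentColRange (hm : m ≤ n) (v : Fin m → R) :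
    colUnipotent n hm (Multiplicative.ofAdd v) ∈ unipotentColRange n R m m := by
  refine mem_unipotentColRange_of ((mem_upperUnitriangular_iff _).2 ⟨fun {i j} hij => ?_, fun i => ?_⟩)
    fun i j hij hj => ?_
  · -- below the diagonal: `j < i`
    have hij' : j < i := hij
    rw [colUnipotent_apply_val, if_neg (ne_of_lt hij').symm, zero_add]
    by_cases hi : (i : ℕ) < m
    · rw [dif_pos hi, if_neg]
      have := Fin.lt_def.1 hij'
      omega
    · rw [dif_neg hi]
  · rw [colUnipotent_apply_val, if_pos rfl]
    by_cases hi : (i : ℕ) < m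
    · rw [dif_pos hi, if_neg (by omega), add_zero]
    · rw [dif_neg hi, add_zero]
  · rw [colUnipotent_apply_val, if_neg (ne_of_lt hij), zero_add]
    have hjm : (j : ℕ) ≠ m := fun e => hj ⟨e.ge, e.le⟩
    by_cases hi : (i : ℕ) < m
    · rw [dif_pos hi, if_neg hjm]
    · rw [dif_neg hi]

/-- The column entries: `u(v)_{i,m} = v_i` for `i < m` (`m < n`). [folklore] -/
theorem colUnipotent_apply_col (hm : m ≤ n) (hmn : m < n) (v : Fin m → R) (i : Fin m) :
    ((colUnipotent n hm (Multiplicative.ofAdd v) : GL (Fin n) R) : Matrix (Fin n) (Fin n) R)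
      (Fin.castLE hm i) ⟨m, hmn⟩ = v i := by
  rw [colUnipotent_apply_val, if_neg (fun e => by have := congrArg Fin.val e; simp at this; omega), zero_add,
    dif_pos (by simp), if_pos rfl]
  rfl

/-- **`u(v) ∈ ratTail n S (m+1)` iff the entries of `v` lie in `S`** (the column `m` belongs to the
corner of size `m + 1`; `u(v)⁻¹ = u(-v)`). [folklore] -/
theorem colUnipotent_mem_ratTail_succ_iff (hm : m ≤ n) (hm1 : m + 1 ≤ n) (v : Fin m → R) :
    colUnipotent n hm (Multiplicative.ofAdd v) ∈ ratTail n S (m + 1) ↔ ∀ i, v i ∈ S := by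
  constructor
  · intro hu i
    have := (hu.2 (Fin.castLE hm i) ⟨m, by omega⟩ (by simp only [Fin.val_castLE]; omega) (by simp)).1
    rwa [colUnipotent_apply_col hm (by omega) v i] at this
  · intro hv
    refine ⟨upperUnitriangular_le_tailUnipotent (m + 1)
      (unipotentColRange_le_upperUnitriangular (colUnipotent_mem_unipotentColRange hm v)), fun i j hi hj => ?_⟩
    have hneg : ((colUnipotent n hm (Multiplicative.ofAdd v))⁻¹ : GL (Fin n) R) =
        colUnipotent n hm (Multiplicative.ofAdd (-v)) := by
      rw [← map_inv, ← ofAdd_neg]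
    rw [hneg, colUnipotent_apply_val, colUnipotent_apply_val]
    refine ⟨S.add_mem ?_ ?_, S.add_mem ?_ ?_⟩
    · split_ifs
      · exact S.one_mem
      · exact S.zero_mem
    · by_cases hi' : (i : ℕ) < m
      · rw [dif_pos hi']
        split_ifs
        · exact hv _
        · exact S.zero_mem
      · rw [dif_neg hi']; exact S.zero_mem
    · split_ifs
      · exact S.one_mem
      · exact S.zero_mem
    · by_cases hi' : (i : ℕ) < m
      · rw [dif_pos hi']
        split_ifs
        · exact S.neg_mem (hv _)
        · exact S.zero_mem
      · rw [dif_neg hi']; exact S.zero_mem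

end Ring

/-! ### The groups `H'_m`, `H_m` of the tower over the adeles -/

section Adelic

variable (n : ℕ) (K : Type) [Field K] [NumberField K] (m : ℕ)

/-- **`H'_m = diag(GL_m(K), 1) · U^{(m)}(𝔸_K) ≤ GL_n(𝔸_K)`**: `Q_m` with `K`-rational corner
(the invariance group of the stage integrands of the Fourier–Whittaker tower; Jacquet–Shalika
(1981), §4). [cite: JacquetShalikaAJM1981, §4] -/
abbrev towerGroup' : Subgroup (GL (Fin n) (AdeleRing (𝓞 K) K)) :=
  ratTail n (algebraMap K (AdeleRing (𝓞 K) K)).range m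

/-- **`H_m = diag(P_m(K), 1) · U^{(m)}(𝔸_K) ≤ GL_n(𝔸_K)`**: the elements of `H'_m` whose corner lies
in the mirabolic, i.e. `H'_m ⊓ Q_{m-1}` (the invariance group of `|Φ_m|²`; `H_n = P_n(K)`,
`H_1 = N_n(𝔸_K)`). [cite: JacquetShalikaAJM1981, §4] -/
abbrev towerGroup : Subgroup (GL (Fin n) (AdeleRing (𝓞 K) K)) :=
  towerGroup' n K m ⊓ tailUnipotent n (AdeleRing (𝓞 K) K) (m - 1)

variable {n K m}

/-- `H_m ≤ H'_m`. [folklore] -/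
theorem towerGroup_le_towerGroup' : towerGroup n K m ≤ towerGroup' n K m := inf_le_left

/-- **`H_{m+1} ≤ H'_m`.** [folklore] -/
theorem towerGroup_succ_le_towerGroup' : towerGroup n K (m + 1) ≤ towerGroup' n K m := by
  rw [towerGroup, Nat.add_sub_cancel]
  exact ratTail_succ_inf_tailUnipotent_le

/-- `U^{(m)}(𝔸_K) = U_{[m,b]}(𝔸_K) ≤ H_m`. [folklore] -/
theorem adelicColRange_le_towerGroup (b : ℕ) : adelicColRange n K m b ≤ towerGroup n K m :=
  le_inf (unipotentColRange_le_ratTail _ b) (unipotentColRange_le_tailUnipotent m b (m - 1))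

/-- `U_{[m,b]}(𝔸_K) ≤ H'_m`. [folklore] -/
theorem adelicColRange_le_towerGroup' (b : ℕ) : adelicColRange n K m b ≤ towerGroup' n K m :=
  (adelicColRange_le_towerGroup b).trans towerGroup_le_towerGroup'

/-- **The rational corner lies in `H'_m`**: `diag(γ_𝔸, 1) ∈ H'_m` for `γ ∈ GL_m(K)`. [folklore] -/
theorem glCorner_ratGL_mem_towerGroup' (hm : m ≤ n) (γ : GL (Fin m) K) :
    glCorner (AdeleRing (𝓞 K) K) hm (ratGL K γ) ∈ towerGroup' n K m := by
  refine glCorner_mem_ratTail hm _ (fun i j => ?_) (fun i j => ?_)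
  · rw [ratGL_apply]; exact ⟨_, rfl⟩
  · rw [← map_inv, ratGL_apply]; exact ⟨_, rfl⟩

/-- **The rational corner lies in `H_{c+1}` iff it is in the mirabolic**: for `γ ∈ GL_{c+1}(K)`,
`diag(γ_𝔸, 1) ∈ H_{c+1} ↔ γ ∈ P_{c+1}(K)` (`mirabolic c K`). [folklore] -/
theorem glCorner_ratGL_mem_towerGroup_iff {c : ℕ} (h : c + 1 ≤ n) (γ : GL (Fin (c + 1)) K) :
    glCorner (AdeleRing (𝓞 K) K) h (ratGL K γ) ∈ towerGroup n K (c + 1) ↔ γ ∈ mirabolic c K := by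
  rw [towerGroup, Subgroup.mem_inf, Nat.add_sub_cancel, and_iff_right (glCorner_ratGL_mem_towerGroup' h γ),
    glCorner_mem_tailUnipotent_iff_row, mem_mirabolic_iff_row]
  refine forall_congr' fun j => ?_
  rw [ratGL_apply]
  constructor
  · intro hj
    apply (AdeleRing.algebraMap_injective (𝓞 K) K)
    rw [hj]
    split_ifs <;> simp
  · intro hj
    rw [hj]
    split_ifs <;> simp

/-- **The column group lies in `H_m`**: `u_m(v) ∈ H_m` for every `v ∈ 𝔸_K^m`. [folklore] -/
theorem colUnipotent_mem_towerGroup (hm : m ≤ n) (v : Fin m → AdeleRing (𝓞 K) K) :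
    colUnipotent n hm (Multiplicative.ofAdd v) ∈ towerGroup n K m :=
  adelicColRange_le_towerGroup m (colUnipotent_mem_unipotentColRange hm v)

/-- **`u_m(v) ∈ H_{m+1}` iff `v` is rational.** [folklore] -/
theorem colUnipotent_mem_towerGroup_succ_iff (hm : m ≤ n) (hm1 : m + 1 ≤ n)
    (v : Fin m → AdeleRing (𝓞 K) K) :
    colUnipotent n hm (Multiplicative.ofAdd v) ∈ towerGroup n K (m + 1) ↔
      ∀ i, v i ∈ (algebraMap K (AdeleRing (𝓞 K) K)).range := by
  rw [towerGroup, Subgroup.mem_inf, Nat.add_sub_cancel, colUnipotent_mem_ratTail_succ_iff hm hm1,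
    and_iff_left]
  exact upperUnitriangular_le_tailUnipotent m
    (unipotentColRange_le_upperUnitriangular (colUnipotent_mem_unipotentColRange hm v))

/-- **The bottom of the tower: `H_1 = N_n(𝔸_K)`.** [folklore] -/
theorem towerGroup_one : towerGroup n K 1 = adelicUnipotent n K := by
  apply le_antisymm
  · intro g hg
    rw [adelicUnipotent, ← tailUnipotent_zero]
    exact hg.2
  · intro u hu
    refine ⟨⟨upperUnitriangular_le_tailUnipotent 1 hu, fun i j hi hj => ?_⟩, ?_⟩
    · have hij : i = j := Fin.ext (by omega)
      subst hij
      have hd := ((mem_upperUnitriangular_iff u).1 hu).2 i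
      have hd' := ((mem_upperUnitriangular_iff u⁻¹).1 ((upperUnitriangular _ _).inv_mem hu)).2 i
      rw [hd, hd']
      exact ⟨⟨1, map_one _⟩, ⟨1, map_one _⟩⟩
    · rw [Nat.sub_self, tailUnipotent_zero]; exact hu

/-! ### The decomposition `g = diag(γ_𝔸, 1) · u` -/

/-- **An invertible adelic matrix with principal entries and principal inverse entries is
rational**: it is `δ_𝔸` for some `δ ∈ GL_n(K)` (entrywise preimages; the products are checked
after the injective `algebraMap`). [folklore] -/
theorem exists_ratGL_eq_of_forall_mem_range {g : GL (Fin n) (AdeleRing (𝓞 K) K)}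
    (h : ∀ i j : Fin n, (g : Matrix (Fin n) (Fin n) (AdeleRing (𝓞 K) K)) i j ∈
        (algebraMap K (AdeleRing (𝓞 K) K)).range ∧
      ((g⁻¹ : GL (Fin n) (AdeleRing (𝓞 K) K)) : Matrix (Fin n) (Fin n) (AdeleRing (𝓞 K) K)) i j ∈
        (algebraMap K (AdeleRing (𝓞 K) K)).range) :
    ∃ δ : GL (Fin n) K, ratGL K δ = g := by
  choose a ha using fun i j => (h i j).1
  choose b hb using fun i j => (h i j).2
  set A : Matrix (Fin n) (Fin n) K := Matrix.of fun i j => a i j with hA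
  set B : Matrix (Fin n) (Fin n) K := Matrix.of fun i j => b i j with hB
  have hAmap : (algebraMap K (AdeleRing (𝓞 K) K)).mapMatrix A = (g : Matrix (Fin n) (Fin n) (AdeleRing (𝓞 K) K)) := by
    ext i j; exact ha i j
  have hBmap : (algebraMap K (AdeleRing (𝓞 K) K)).mapMatrix B =
      ((g⁻¹ : GL (Fin n) (AdeleRing (𝓞 K) K)) : Matrix (Fin n) (Fin n) (AdeleRing (𝓞 K) K)) := by
    ext i j; exact hb i j
  have hinj : Function.Injective ((algebraMap K (AdeleRing (𝓞 K) K)).mapMatrix :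
      Matrix (Fin n) (Fin n) K → Matrix (Fin n) (Fin n) (AdeleRing (𝓞 K) K)) :=
    fun X Y hXY => Matrix.ext fun i j =>
      (AdeleRing.algebraMap_injective (𝓞 K) K) (congrFun (congrFun hXY i) j)
  have hAB : A * B = 1 := hinj (by rw [map_mul, hAmap, hBmap, ← Units.val_mul, mul_inv_cancel,
    Units.val_one, map_one])
  have hBA : B * A = 1 := hinj (by rw [map_mul, hAmap, hBmap, ← Units.val_mul, inv_mul_cancel,
    Units.val_one, map_one])
  refine ⟨⟨A, B, hAB, hBA⟩, Units.ext ?_⟩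
  exact hAmap

/-- **The corner homomorphism entrywise** (matrix level): `g_{ij}` on the block `i, j < m`, the
identity on `i, j ≥ m`, zero elsewhere (cf. `glCorner_apply_val`). [folklore] -/
theorem cornerMatrixHom_apply_val {R : Type*} [CommRing R] (hm : m ≤ n) (A : Matrix (Fin m) (Fin m) R)
    (i j : Fin n) :
    cornerMatrixHom R hm A i j =
      if hi : (i : ℕ) < m then (if hj : (j : ℕ) < m then A ⟨i, hi⟩ ⟨j, hj⟩ else 0)
      else (if (j : ℕ) < m then 0 else if i = j then 1 else 0) := by
  rw [cornerMatrixHom_apply, Matrix.reindex_apply, Matrix.submatrix_apply]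
  by_cases hi : (i : ℕ) < m <;> by_cases hj : (j : ℕ) < m
  · rw [finBlockEquiv_symm_of_lt hm i hi, finBlockEquiv_symm_of_lt hm j hj, Matrix.fromBlocks_apply₁₁,
      dif_pos hi, dif_pos hj]
  · rw [finBlockEquiv_symm_of_lt hm i hi, finBlockEquiv_symm_of_le hm j (not_lt.1 hj),
      Matrix.fromBlocks_apply₁₂, dif_pos hi, dif_neg hj, Matrix.zero_apply]
  · rw [finBlockEquiv_symm_of_le hm i (not_lt.1 hi), finBlockEquiv_symm_of_lt hm j hj,
      Matrix.fromBlocks_apply₂₁, dif_neg hi, if_pos hj, Matrix.zero_apply]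
  · rw [finBlockEquiv_symm_of_le hm i (not_lt.1 hi), finBlockEquiv_symm_of_le hm j (not_lt.1 hj),
      Matrix.fromBlocks_apply₂₂, dif_neg hi, if_neg hj, Matrix.one_apply]
    by_cases hij : i = j
    · subst hij; simp
    · rw [if_neg hij, if_neg]
      intro h'
      apply hij
      have : (i : ℕ) - m = (j : ℕ) - m := by simpa using congrArg Fin.val h'
      exact Fin.ext (by omega)

/-- **An invertible matrix in corner form is a corner**: over a field, if `δ₀ ∈ GL_n(F)` has
`(δ₀)_{ij} = δ_{ij}` unless `i, j < m`, then `δ₀ = diag(γ, 1)` for some `γ ∈ GL_m(F)` (the corner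
block; it is invertible because `det δ₀ = det γ`). [folklore] -/
theorem exists_glCorner_eq_of_cornerForm {F : Type*} [Field F] (hm : m ≤ n) (δ₀ : GL (Fin n) F)
    (hform : ∀ i j : Fin n, ¬ ((i : ℕ) < m ∧ (j : ℕ) < m) →
      (δ₀ : Matrix (Fin n) (Fin n) F) i j = if i = j then 1 else 0) :
    ∃ γ : GL (Fin m) F, glCorner F hm γ = δ₀ := by
  set C : Matrix (Fin m) (Fin m) F := Matrix.of fun i j =>
    (δ₀ : Matrix (Fin n) (Fin n) F) ⟨i, by omega⟩ ⟨j, by omega⟩ with hC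
  have hmat : cornerMatrixHom F hm C = (δ₀ : Matrix (Fin n) (Fin n) F) := by
    ext i j
    rw [cornerMatrixHom_apply_val]
    by_cases hi : (i : ℕ) < m <;> by_cases hj : (j : ℕ) < m
    · rw [dif_pos hi, dif_pos hj, hC, Matrix.of_apply]
    · rw [dif_pos hi, dif_neg hj, hform i j (fun h => hj h.2), if_neg]
      intro e; rw [e] at hi; exact hj hi
    · rw [dif_neg hi, if_pos hj, hform i j (fun h => hi h.1), if_neg]
      intro e; rw [e] at hi; exact hi hj
    · rw [dif_neg hi, if_neg hj, hform i j (fun h => hi h.1)]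
  have hdet : C.det = (δ₀ : Matrix (Fin n) (Fin n) F).det := by
    rw [← hmat, cornerMatrixHom_apply, Matrix.det_reindex_self, Matrix.det_fromBlocks_zero₂₁, Matrix.det_one,
      mul_one]
  have hunit : IsUnit C.det := by
    rw [hdet, ← Matrix.GeneralLinearGroup.val_det_apply]
    exact Units.isUnit _
  refine ⟨Matrix.nonsingInvUnit C hunit, Units.ext ?_⟩
  exact hmat

/-- The entries of `cornerize` outside the corner are `δ_{ij}`, inside they are those of `g`
(restated from `cornerMatrix_apply`). [folklore] -/
theorem cornerize_apply_of_not {R : Type*} [CommRing R] {e : ℕ} (d : ℕ) (hed : e ≤ d) (g : GL (Fin n) R)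
    (hg : g ∈ tailUnipotent n R e) (i j : Fin n) (h : ¬ ((i : ℕ) < d ∧ (j : ℕ) < d)) :
    ((cornerize d hed g hg : GL (Fin n) R) : Matrix (Fin n) (Fin n) R) i j = if i = j then 1 else 0 := by
  rw [coe_cornerize, cornerMatrix_apply, if_neg h]

/-- **The corner of `g ∈ H'_m` is the adelic image of a rational matrix**: there is `γ ∈ GL_m(K)`
with `diag(γ_𝔸, 1) = cornerize m g`. [folklore] -/
theorem exists_glCorner_ratGL_eq_cornerize (hm : m ≤ n) {g : GL (Fin n) (AdeleRing (𝓞 K) K)}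
    (hg : g ∈ towerGroup' n K m) :
    ∃ γ : GL (Fin m) K, glCorner (AdeleRing (𝓞 K) K) hm (ratGL K γ) = cornerize m le_rfl g hg.1 := by
  set Γ := cornerize m le_rfl g hg.1 with hΓ
  -- all entries and inverse entries of the corner are principal
  have hrat : ∀ i j : Fin n, (Γ : Matrix (Fin n) (Fin n) (AdeleRing (𝓞 K) K)) i j ∈
        (algebraMap K (AdeleRing (𝓞 K) K)).range ∧
      ((Γ⁻¹ : GL (Fin n) (AdeleRing (𝓞 K) K)) : Matrix (Fin n) (Fin n) (AdeleRing (𝓞 K) K)) i j ∈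
        (algebraMap K (AdeleRing (𝓞 K) K)).range := by
    intro i j
    by_cases h : (i : ℕ) < m ∧ (j : ℕ) < m
    · rw [hΓ, coe_cornerize, coe_cornerize_inv, cornerMatrix_apply, cornerMatrix_apply, if_pos h, if_pos h]
      exact hg.2 i j h.1 h.2
    · rw [hΓ, coe_cornerize, coe_cornerize_inv, cornerMatrix_apply, cornerMatrix_apply, if_neg h, if_neg h]
      split_ifs
      · exact ⟨⟨1, map_one _⟩, ⟨1, map_one _⟩⟩
      · exact ⟨⟨0, map_zero _⟩, ⟨0, map_zero _⟩⟩
  obtain ⟨δ₀, hδ₀⟩ := exists_ratGL_eq_of_forall_mem_range hrat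
  -- `δ₀` is in corner form
  have hform : ∀ i j : Fin n, ¬ ((i : ℕ) < m ∧ (j : ℕ) < m) →
      (δ₀ : Matrix (Fin n) (Fin n) K) i j = if i = j then 1 else 0 := by
    intro i j h
    apply (AdeleRing.algebraMap_injective (𝓞 K) K)
    have := congrFun (congrFun (congrArg (fun u : GL (Fin n) (AdeleRing (𝓞 K) K) =>
      (u : Matrix (Fin n) (Fin n) (AdeleRing (𝓞 K) K))) hδ₀) i) j
    rw [ratGL_apply] at this
    rw [this, hΓ, cornerize_apply_of_not m le_rfl g hg.1 i j h]
    split_ifs <;> simp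
  obtain ⟨γ, hγ⟩ := exists_glCorner_eq_of_cornerForm hm δ₀ hform
  exact ⟨γ, by rw [← ratGL_glCorner, hγ, hδ₀]⟩

/-- **Decomposition of `H'_m`**: every `g ∈ H'_m` is `diag(γ_𝔸, 1) · u` with `γ ∈ GL_m(K)` and
`u ∈ U^{(m)}(𝔸_K) = U_{[m, n-1]}(𝔸_K)`. [cite: CogdellAnalyticTheory2004, §1.1] -/
theorem exists_glCorner_ratGL_mul_eq (hm : m ≤ n) {g : GL (Fin n) (AdeleRing (𝓞 K) K)}
    (hg : g ∈ towerGroup' n K m) :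
    ∃ (γ : GL (Fin m) K) (u : GL (Fin n) (AdeleRing (𝓞 K) K)), u ∈ adelicColRange n K m (n - 1) ∧
      g = glCorner (AdeleRing (𝓞 K) K) hm (ratGL K γ) * u := by
  obtain ⟨γ, hγ⟩ := exists_glCorner_ratGL_eq_cornerize hm hg
  refine ⟨γ, (cornerize m le_rfl g hg.1)⁻¹ * g,
    cornerize_inv_mul_mem_unipotentColRange m le_rfl (by omega) g hg.1, ?_⟩
  rw [hγ, mul_inv_cancel_left]

/-- The rational corner lies in `GL_m ≤ GL_n` (`cornerGL`). [folklore] -/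
theorem glCorner_mem_cornerGL {R : Type*} [CommRing R] (hm : m ≤ n) (γ : GL (Fin m) R) :
    glCorner R hm γ ∈ cornerGL n R m := by
  intro i j hij
  rw [glCorner_apply_val]
  rcases hij with hi | hj
  · rw [dif_neg (by omega)]
    by_cases hj : (j : ℕ) < m
    · rw [if_pos hj, if_neg (fun e => by rw [e] at hi; omega)]
    · rw [if_neg hj]
  · by_cases hi : (i : ℕ) < m
    · rw [dif_pos hi, dif_neg (by omega), if_neg (fun e => by rw [e] at hi; omega)]
    · rw [dif_neg hi, if_neg (by omega)]

/-- `glCorner` is injective. [folklore] -/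
theorem glCorner_injective {R : Type*} [CommRing R] (hm : m ≤ n) : Function.Injective (glCorner R hm) := by
  intro γ γ' h
  refine Units.ext (Matrix.ext fun i j => ?_)
  have := congrFun (congrFun (congrArg (fun u : GL (Fin n) R => (u : Matrix (Fin n) (Fin n) R)) h)
    ⟨i, by omega⟩) ⟨j, by omega⟩
  rw [glCorner_apply_val, glCorner_apply_val, dif_pos i.isLt, dif_pos j.isLt, dif_pos i.isLt, dif_pos j.isLt]
    at this
  exact this

/-- `ratGL` is injective. [folklore] -/
theorem ratGL_injective : Function.Injective (ratGL K : GL (Fin m) K → GL (Fin m) (AdeleRing (𝓞 K) K)) := by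
  intro γ γ' h
  refine Units.ext (Matrix.ext fun i j => (AdeleRing.algebraMap_injective (𝓞 K) K) ?_)
  have := congrFun (congrFun (congrArg (fun u : GL (Fin m) (AdeleRing (𝓞 K) K) =>
    (u : Matrix (Fin m) (Fin m) (AdeleRing (𝓞 K) K))) h) i) j
  rwa [ratGL_apply, ratGL_apply] at this

/-- **Uniqueness of the decomposition**: `diag(γ_𝔸, 1) u = diag(γ'_𝔸, 1) u'` with `u, u' ∈ U_{[m,b]}(𝔸_K)`
forces `γ = γ'` and `u = u'`. [folklore] -/
theorem glCorner_ratGL_mul_eq_iff (hm : m ≤ n) {b : ℕ} {γ γ' : GL (Fin m) K}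
    {u u' : GL (Fin n) (AdeleRing (𝓞 K) K)} (hu : u ∈ adelicColRange n K m b)
    (hu' : u' ∈ adelicColRange n K m b) :
    glCorner (AdeleRing (𝓞 K) K) hm (ratGL K γ) * u = glCorner (AdeleRing (𝓞 K) K) hm (ratGL K γ') * u' ↔
      γ = γ' ∧ u = u' := by
  constructor
  · intro he
    obtain ⟨h1, h2⟩ := corner_decomposition_unique (glCorner_mem_cornerGL hm _) (glCorner_mem_cornerGL hm _)
      hu hu' he
    exact ⟨ratGL_injective (glCorner_injective hm h1), h2⟩
  · rintro ⟨rfl, rfl⟩; rfl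

/-! ### Topology: closedness, and `U^{(m)}(𝔸_K)` is open in `H'_m` -/

section Topology

/-- The entry maps `g ↦ g_{ij}` on `GL_n` are continuous. [folklore] -/
theorem continuous_gl_apply {R : Type*} [CommRing R] [TopologicalSpace R] (i j : Fin n) :
    Continuous fun g : GL (Fin n) R => (g : Matrix (Fin n) (Fin n) R) i j :=
  (Continuous.matrix_elem Units.continuous_val i j)

/-- The inverse-entry maps `g ↦ (g⁻¹)_{ij}` on `GL_n` are continuous. [folklore] -/
theorem continuous_gl_inv_apply {R : Type*} [CommRing R] [TopologicalSpace R] (i j : Fin n) :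
    Continuous fun g : GL (Fin n) R => ((g⁻¹ : GL (Fin n) R) : Matrix (Fin n) (Fin n) R) i j :=
  (Continuous.matrix_elem Units.continuous_coe_inv i j)

/-- **`Q_d` is closed** (entry conditions). [folklore] -/
theorem isClosed_tailUnipotent {R : Type*} [CommRing R] [TopologicalSpace R] [T2Space R] (d : ℕ) :
    IsClosed (tailUnipotent n R d : Set (GL (Fin n) R)) := by
  have : (tailUnipotent n R d : Set (GL (Fin n) R)) = ⋂ i : Fin n, ⋂ j : Fin n,
      {g : GL (Fin n) R | d ≤ (i : ℕ) → j ≤ i →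
        (g : Matrix (Fin n) (Fin n) R) i j = if i = j then 1 else 0} := by
    ext g; simp only [SetLike.mem_coe, mem_tailUnipotent_iff, Set.mem_iInter, Set.mem_setOf_eq]
  rw [this]
  refine isClosed_iInter fun i => isClosed_iInter fun j => ?_
  by_cases hi : d ≤ (i : ℕ)
  · by_cases hji : j ≤ i
    · simp only [hi, hji, true_implies]
      exact isClosed_eq (continuous_gl_apply i j) continuous_const
    · simp [hji]
  · simp [hi]

/-- **`H'_m` is closed in `GL_n(𝔸_K)`** (`Q_m` is closed and `K ⊂ 𝔸_K` is closed). [folklore] -/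
theorem isClosed_towerGroup' : IsClosed (towerGroup' n K m : Set (GL (Fin n) (AdeleRing (𝓞 K) K))) := by
  haveI := t2Space_adeleRing K
  have hP : IsClosed ((algebraMap K (AdeleRing (𝓞 K) K)).range : Set (AdeleRing (𝓞 K) K)) :=
    isClosed_principalSubgroup K
  have : (towerGroup' n K m : Set (GL (Fin n) (AdeleRing (𝓞 K) K))) =
      (tailUnipotent n (AdeleRing (𝓞 K) K) m : Set (GL (Fin n) (AdeleRing (𝓞 K) K))) ∩ ⋂ i : Fin n, ⋂ j : Fin n,
        {g : GL (Fin n) (AdeleRing (𝓞 K) K) | (i : ℕ) < m → (j : ℕ) < m →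
          (g : Matrix (Fin n) (Fin n) (AdeleRing (𝓞 K) K)) i j ∈ (algebraMap K (AdeleRing (𝓞 K) K)).range ∧
          ((g⁻¹ : GL (Fin n) (AdeleRing (𝓞 K) K)) : Matrix (Fin n) (Fin n) (AdeleRing (𝓞 K) K)) i j ∈
            (algebraMap K (AdeleRing (𝓞 K) K)).range} := by
    ext g
    simp only [SetLike.mem_coe, mem_ratTail_iff, Set.mem_inter_iff, Set.mem_iInter, Set.mem_setOf_eq]
  rw [this]
  refine (isClosed_tailUnipotent m).inter (isClosed_iInter fun i => isClosed_iInter fun j => ?_)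
  by_cases hi : (i : ℕ) < m
  · by_cases hj : (j : ℕ) < m
    · simp only [hi, hj, true_implies]
      exact (hP.preimage (continuous_gl_apply i j)).inter (hP.preimage (continuous_gl_inv_apply i j))
    · simp [hj]
  · simp [hi]

/-- **`H_m` is closed in `GL_n(𝔸_K)`.** [folklore] -/
theorem isClosed_towerGroup : IsClosed (towerGroup n K m : Set (GL (Fin n) (AdeleRing (𝓞 K) K))) := by
  haveI := t2Space_adeleRing K
  exact isClosed_towerGroup'.inter (isClosed_tailUnipotent (m - 1))

/-- **Inside `H'_m`, membership in `U^{(m)}(𝔸_K)` is the vanishing of the corner**: for `g ∈ H'_m`,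
`g ∈ U_{[m,n-1]}(𝔸_K)` iff `g_{ij} = δ_{ij}` for all `i, j < m`. [folklore] -/
theorem mem_adelicColRange_iff_of_mem_towerGroup' {g : GL (Fin n) (AdeleRing (𝓞 K) K)}
    (hg : g ∈ towerGroup' n K m) :
    g ∈ adelicColRange n K m (n - 1) ↔ ∀ i j : Fin n, (i : ℕ) < m → (j : ℕ) < m →
      (g : Matrix (Fin n) (Fin n) (AdeleRing (𝓞 K) K)) i j = if i = j then 1 else 0 := by
  constructor
  · intro hu i j _ hj
    exact apply_of_not_inColRange hu i (fun h => absurd h.1 (by omega))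
  · intro hcor
    have h1 : cornerize m le_rfl g hg.1 = 1 := by
      refine Units.ext (Matrix.ext fun i j => ?_)
      rw [coe_cornerize, cornerMatrix_apply, Units.val_one, Matrix.one_apply]
      by_cases h : (i : ℕ) < m ∧ (j : ℕ) < m
      · rw [if_pos h]; exact hcor i j h.1 h.2
      · rw [if_neg h]
    have := cornerize_inv_mul_mem_unipotentColRange m le_rfl (b := n - 1) (by omega) g hg.1
    rwa [h1, inv_one, one_mul] at this

/-- **`U^{(m)}(𝔸_K)` is open in `H'_m`** (relative topology): the corner entries of elements of
`H'_m` lie in the discrete subset `K ⊂ 𝔸_K`, so the conditions `g_{ij} = δ_{ij}` (`i, j < m`) are open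
in `H'_m`. [folklore] -/
theorem isOpen_adelicColRange_subgroupOf_towerGroup' :
    IsOpen (((adelicColRange n K m (n - 1)).subgroupOf (towerGroup' n K m) : Subgroup (towerGroup' n K m)) :
      Set (towerGroup' n K m)) := by
  haveI := AdeleRing.discreteTopology_principalSubgroup K
  -- the set, described by the corner entries
  have hset : (((adelicColRange n K m (n - 1)).subgroupOf (towerGroup' n K m) : Subgroup (towerGroup' n K m)) :
      Set (towerGroup' n K m)) = ⋂ i : Fin n, ⋂ j : Fin n, {x : towerGroup' n K m | (i : ℕ) < m → (j : ℕ) < m →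
        ((x : GL (Fin n) (AdeleRing (𝓞 K) K)) : Matrix (Fin n) (Fin n) (AdeleRing (𝓞 K) K)) i j =
          if i = j then 1 else 0} := by
    ext x
    simp only [SetLike.mem_coe, Subgroup.mem_subgroupOf, Set.mem_iInter, Set.mem_setOf_eq]
    exact mem_adelicColRange_iff_of_mem_towerGroup' x.2
  rw [hset]
  refine isOpen_iInter_of_finite fun i => isOpen_iInter_of_finite fun j => ?_
  by_cases hi : (i : ℕ) < m
  · by_cases hj : (j : ℕ) < m
    · simp only [hi, hj, true_implies]
      -- the entry map into the discrete set of principal adeles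
      set c : AdeleRing (𝓞 K) K := if i = j then 1 else 0 with hc
      have hcmem : c ∈ AdeleRing.principalSubgroup (𝓞 K) K := by
        rw [hc]; split_ifs
        · exact ⟨1, map_one _⟩
        · exact ⟨0, map_zero _⟩
      let f : towerGroup' n K m → AdeleRing.principalSubgroup (𝓞 K) K := fun x =>
        ⟨((x : GL (Fin n) (AdeleRing (𝓞 K) K)) : Matrix (Fin n) (Fin n) (AdeleRing (𝓞 K) K)) i j,
          (x.2.2 i j hi hj).1⟩
      have hf : Continuous f :=
        ((continuous_gl_apply i j).comp continuous_subtype_val).subtype_mk _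
      have : {x : towerGroup' n K m | ((x : GL (Fin n) (AdeleRing (𝓞 K) K)) :
          Matrix (Fin n) (Fin n) (AdeleRing (𝓞 K) K)) i j = c} = f ⁻¹' {⟨c, hcmem⟩} := by
        ext x
        simp only [Set.mem_setOf_eq, Set.mem_preimage, Set.mem_singleton_iff, Subtype.ext_iff, f]
      rw [this]
      exact (isOpen_discrete _).preimage hf
    · simp [hj]
  · simp [hi]

/-- **`H_m` is open in `H'_m`** (it contains the open subgroup `U^{(m)}(𝔸_K)` of `H'_m`). [folklore] -/
theorem isOpen_towerGroup_subgroupOf_towerGroup' :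
    IsOpen (((towerGroup n K m).subgroupOf (towerGroup' n K m) : Subgroup (towerGroup' n K m)) :
      Set (towerGroup' n K m)) :=
  Subgroup.isOpen_mono (Subgroup.subgroupOf_mono (towerGroup' n K m) (adelicColRange_le_towerGroup (n - 1)))
    isOpen_adelicColRange_subgroupOf_towerGroup'

/-- **The coset space `H'_m ⧸ H_m` is discrete.** [folklore] -/
theorem discreteTopology_towerGroup'_quotient :
    DiscreteTopology (towerGroup' n K m ⧸ (towerGroup n K m).subgroupOf (towerGroup' n K m)) :=
  QuotientGroup.discreteTopology isOpen_towerGroup_subgroupOf_towerGroup'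

end Topology

end Adelic

end Literature.NumberTheory.Automorphic
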